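import Literature.Claims.NS.Rockwell2025
import Literature.Analysis.FluidPDE.SpaceTimeMollifier
import Literature.Analysis.FluidPDE.SchefferTestFunction
import Literature.Analysis.UnboundedOperators.HeatKernelHeatEquation
import HarnessLib

/-!
# C88 `Rockwell2025` — kernel countermodel to the heat-equation claim (62) p.15 (`Step_62`)

The free heat flow of the Gauss–Weierstrass kernel, `w(t, x) = G_{ν(t+1)}(x) e₁`, is a jointly smooth
classical solution of `∂ₜw = νΔw` on `ℝ³ × [0,∞)` with finite energy, and
`‖w(t)‖²_{L²} = (8πν(1+t))^{-3/2}`, i.e. `‖w(t)‖² = (1+t)^{-3/2} ‖w(0)‖²` — slower than the printed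
`C‖w(0)‖²/(1+t)^{K−3}` for every `K > 9/2`, in particular for every `K > 5` of Theorem 8.1. Also `not_Step_70` (the
elementary integral (70) p.16 diverges for `5 < K ≤ 6`). Kit by the typist (ns-claims-typist-11 g2) for the
refuter of record, to be filed UNCHANGED under conv. (b); nothing here asserts anything about Navier–Stokes.
WHAT THIS IS NOT: not a claim about NS regularity or blow-up; not a claim about any author beyond the
typed locator.
-/

set_option linter.dupNamespace false

noncomputable section

open Set Function Filter MeasureTheory Real
open scoped Topology ENNReal NNReal ContDiff Laplacian

namespace Summit.NavierStokesRegularity.NavierStokesRegularity.Theorems.Rockwell2025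

open Literature.Claims.NS.Rockwell2025 Literature.Analysis.FluidPDE Literature.Analysis.UnboundedOperators

/-- The unit vector `e₁`. -/
def e1 : EuclideanSpace ℝ (Fin 3) := EuclideanSpace.single 0 1

/-- `‖e₁‖ = 1`. [folklore] -/
theorem norm_e1 : ‖e1‖ = 1 := by
  simp [e1]

/-- The Gaussian heat flow `w(t, x) = G_{ν(t+1)}(x) e₁`. -/
def gaussFlow (ν : ℝ) (t : ℝ) (x : EuclideanSpace ℝ (Fin 3)) : EuclideanSpace ℝ (Fin 3) :=
  heatKernel (ν * (t + 1)) x • e1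

/-- Joint smoothness on `[0,∞) × ℝ³` (indeed on `(-1,∞) × ℝ³`). -/
theorem isSmoothSpaceTimeOn_gaussFlow {ν : ℝ} (hν : 0 < ν) :
    IsSmoothSpaceTimeOn (Ici 0) (gaussFlow ν) := by
  unfold IsSmoothSpaceTimeOn
  have hΨ : ContDiff ℝ ∞ (fun q : ℝ × EuclideanSpace ℝ (Fin 3) => ((ν * (q.1 + 1), q.2) : ℝ × _)) :=
    ((contDiff_const.mul (contDiff_fst.add contDiff_const)).prodMk contDiff_snd)
  have hmaps : MapsTo (fun q : ℝ × EuclideanSpace ℝ (Fin 3) => ((ν * (q.1 + 1), q.2) : ℝ × _))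
      (Ici (0 : ℝ) ×ˢ univ) (Ioi (0 : ℝ) ×ˢ univ) := by
    rintro ⟨t, x⟩ ⟨ht, -⟩
    refine ⟨?_, mem_univ _⟩
    have ht' : (0 : ℝ) ≤ t := ht
    show 0 < ν * (t + 1)
    positivity
  have hK := (contDiffOn_uncurry_heatKernel (E := EuclideanSpace ℝ (Fin 3)) (m := ∞)).comp
    hΨ.contDiffOn hmaps
  have hsm : ContDiffOn ℝ ∞ (fun q : ℝ × EuclideanSpace ℝ (Fin 3) =>
      heatKernel (ν * (q.1 + 1)) q.2 • e1) (Ici (0 : ℝ) ×ˢ univ) := hK.smul contDiffOn_const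
  refine hsm.congr fun q _ => ?_
  obtain ⟨t, x⟩ := q
  rfl

/-- The heat equation `∂ₜw = νΔw` on `[0,∞) × ℝ³`. -/
theorem gaussFlow_heat {ν : ℝ} (hν : 0 < ν) :
    ∀ t ∈ Ici (0 : ℝ), ∀ x, timeDerivWithin (Ici 0) (gaussFlow ν) t x = ν • (Δ (gaussFlow ν t)) x := by
  intro t ht x
  have ht' : (0 : ℝ) ≤ t := ht
  have hσ : 0 < ν * (t + 1) := by positivity
  set σ : ℝ := ν * (t + 1) with hσdef
  -- time derivative
  have h1 := hasDerivAt_heatKernel_time (E := EuclideanSpace ℝ (Fin 3)) hσ x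
  have h2 : HasDerivAt (fun s : ℝ => ν * (s + 1)) ν t := by
    simpa using ((hasDerivAt_id t).add_const 1).const_mul ν
  have h3 : HasDerivAt (fun s : ℝ => heatKernel (ν * (s + 1)) x)
      (((‖x‖ ^ 2 / (4 * σ ^ 2) - (Module.finrank ℝ (EuclideanSpace ℝ (Fin 3)) : ℝ) / (2 * σ)) *
        heatKernel σ x) * ν) t := by
    have := HasDerivAt.comp t (h₂ := fun s : ℝ => heatKernel s x) (h := fun s : ℝ => ν * (s + 1))
      (by rw [← hσdef]; exact h1) h2
    exact this
  have h4 : HasDerivWithinAt (fun s : ℝ => gaussFlow ν s x)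
      ((((‖x‖ ^ 2 / (4 * σ ^ 2) - (Module.finrank ℝ (EuclideanSpace ℝ (Fin 3)) : ℝ) / (2 * σ)) *
        heatKernel σ x) * ν) • e1) (Ici 0) t := (h3.smul_const e1).hasDerivWithinAt
  rw [timeDerivWithin_apply, h4.derivWithin (uniqueDiffOn_Ici 0 t ht)]
  -- Laplacian
  have hlap : (Δ (gaussFlow ν t)) x = (Δ (heatKernel (E := EuclideanSpace ℝ (Fin 3)) σ)) x • e1 := by
    show (Δ (fun y : EuclideanSpace ℝ (Fin 3) => heatKernel (ν * (t + 1)) y • e1)) x = _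
    rw [← hσdef]
    exact laplacian_smul_const ((Scheffer.contDiff_heatKernel (m := 2) σ)) e1 x
  rw [hlap, Scheffer.laplacian_heatKernel σ x, smul_smul]
  congr 1
  ring

/-- The energy of the Gaussian flow: `∫ ‖w(t,x)‖² dx = (4πσ)^{-3} (2πσ)^{3/2}`, `σ = ν(t+1)`, as a real
integral of the square. -/
theorem integral_sq_heatKernel {σ : ℝ} (hσ : 0 < σ) :
    ∫ x : EuclideanSpace ℝ (Fin 3), heatKernel σ x ^ 2 =
      ((4 * π * σ) ^ (-(3 : ℝ) / 2)) ^ 2 * (π / (1 / (2 * σ))) ^ ((3 : ℝ) / 2) := by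
  have hb : 0 < 1 / (2 * σ) := by positivity
  have h1 := GaussianFourier.integral_rexp_neg_mul_sq_norm (V := EuclideanSpace ℝ (Fin 3)) hb
  rw [finrank_euclideanSpace_fin] at h1
  have hsq : ∀ x : EuclideanSpace ℝ (Fin 3), heatKernel σ x ^ 2 =
      ((4 * π * σ) ^ (-(3 : ℝ) / 2)) ^ 2 * rexp (-(1 / (2 * σ)) * ‖x‖ ^ 2) := by
    intro x
    rw [heatKernel_eq, finrank_euclideanSpace_fin, mul_pow, ← Real.exp_nat_mul]
    congr 2
    push_cast
    field_simp
    ring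
  simp_rw [hsq, integral_const_mul]
  rw [h1]
  norm_num

/-- The energy as a function of `σ`: `E(σ) = A σ^{-3/2}` with `A > 0` independent of `σ`. -/
theorem integral_sq_heatKernel_eq {σ : ℝ} (hσ : 0 < σ) :
    ∫ x : EuclideanSpace ℝ (Fin 3), heatKernel σ x ^ 2 =
      ((4 * π) ^ (-(3 : ℝ)) * (2 * π) ^ ((3 : ℝ) / 2)) * σ ^ (-(3 : ℝ) / 2) := by
  rw [integral_sq_heatKernel hσ]
  have hπ : 0 < π := Real.pi_pos
  have hA1 : ((4 * π * σ) ^ (-(3 : ℝ) / 2)) ^ 2 = (4 * π * σ) ^ (-(3 : ℝ)) := by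
    rw [← Real.rpow_natCast, ← Real.rpow_mul (by positivity)]
    norm_num
  have hA2 : (π / (1 / (2 * σ))) ^ ((3 : ℝ) / 2) = (2 * π * σ) ^ ((3 : ℝ) / 2) := by
    congr 1
    field_simp
  have hA3 : (4 * π * σ) ^ (-(3 : ℝ)) = (4 * π) ^ (-(3 : ℝ)) * σ ^ (-(3 : ℝ)) :=
    Real.mul_rpow (by positivity) hσ.le
  have hA4 : (2 * π * σ) ^ ((3 : ℝ) / 2) = (2 * π) ^ ((3 : ℝ) / 2) * σ ^ ((3 : ℝ) / 2) :=
    Real.mul_rpow (by positivity) hσ.le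
  have hA5 : σ ^ (-(3 : ℝ)) * σ ^ ((3 : ℝ) / 2) = σ ^ (-(3 : ℝ) / 2) := by
    rw [← Real.rpow_add hσ]
    norm_num
  rw [hA1, hA2, hA3, hA4, ← hA5]
  ring

/-- Integrability of `G_σ²`. -/
theorem integrable_sq_heatKernel {σ : ℝ} (hσ : 0 < σ) :
    Integrable (fun x : EuclideanSpace ℝ (Fin 3) => heatKernel σ x ^ 2) := by
  have hG := integrable_heatKernel_holds (E := EuclideanSpace ℝ (Fin 3)) hσ
  refine (hG.const_mul ((4 * π * σ) ^ (-(Module.finrank ℝ (EuclideanSpace ℝ (Fin 3)) : ℝ) / 2))).mono'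
    ((continuous_heatKernel σ).pow 2).aestronglyMeasurable (Eventually.of_forall fun x => ?_)
  rw [Real.norm_eq_abs, abs_of_nonneg (sq_nonneg _), sq]
  exact mul_le_mul_of_nonneg_right (heatKernel_le hσ x) (heatKernel_pos hσ x).le

/-- The lower Lebesgue energy of the Gaussian flow equals `ofReal` of the real energy. -/
theorem lintegral_gaussFlow {ν : ℝ} (hν : 0 < ν) {t : ℝ} (ht : 0 ≤ t) :
    (∫⁻ x, ‖gaussFlow ν t x‖ₑ ^ 2) =
      ENNReal.ofReal (∫ x : EuclideanSpace ℝ (Fin 3), heatKernel (ν * (t + 1)) x ^ 2) := by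
  have hσ : 0 < ν * (t + 1) := by positivity
  rw [ofReal_integral_eq_lintegral_ofReal (integrable_sq_heatKernel hσ)
    (Eventually.of_forall fun x => sq_nonneg _)]
  refine lintegral_congr fun x => ?_
  rw [gaussFlow, ← ofReal_norm, norm_smul, norm_e1, mul_one, Real.norm_eq_abs,
    abs_of_pos (heatKernel_pos hσ x), ENNReal.ofReal_pow (heatKernel_pos hσ x).le]

/-- **`Step_62` is false**: the Gaussian heat flow decays like `(1+t)^{-3/2}` in `L²`, not like
`(1+t)^{-(K−3)}` with `K = 10` (any `K > 9/2` would do). -/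
theorem not_Step_62 : ¬ Step_62 := by
  intro h
  obtain ⟨C, hC0, hC⟩ := h 1 one_pos 10 (by norm_num)
  have hflow := hC (gaussFlow 1) (isSmoothSpaceTimeOn_gaussFlow one_pos) (gaussFlow_heat one_pos)
  -- finite initial energy
  have hE0 : (∫⁻ x, ‖gaussFlow 1 0 x‖ₑ ^ 2) < (⊤ : ℝ≥0∞) := by
    rw [lintegral_gaussFlow one_pos le_rfl]
    exact ENNReal.ofReal_lt_top
  -- the energy identity `E(t) = A (t+1)^{-3/2}`
  set A : ℝ := (4 * π) ^ (-(3 : ℝ)) * (2 * π) ^ ((3 : ℝ) / 2) with hA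
  have hApos : 0 < A := by rw [hA]; positivity
  have hEt : ∀ t : ℝ, 0 ≤ t → (∫⁻ x, ‖gaussFlow 1 t x‖ₑ ^ 2) =
      ENNReal.ofReal (A * (t + 1) ^ (-(3 : ℝ) / 2)) := by
    intro t ht
    rw [lintegral_gaussFlow one_pos ht, integral_sq_heatKernel_eq (by positivity), one_mul]
  -- evaluate the printed inequality at `t` with `(1+t)^{11/2} > C`: take `t = C`
  have key := hflow hE0 C hC0
  rw [hEt C hC0, hEt 0 le_rfl, zero_add, Real.one_rpow, mul_one,
    ← ENNReal.ofReal_mul (div_nonneg hC0 (Real.rpow_nonneg (by linarith) _))] at key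
  have key' := (ENNReal.ofReal_le_ofReal_iff (by positivity)).mp key
  -- `A (C+1)^{-3/2} ≤ C/(1+C)^7 · A`, i.e. `(1+C)^{7 - 3/2} ≤ C`, contradiction since `(1+C)^{11/2} ≥ 1 + C > C`
  have hb : (1 : ℝ) ≤ 1 + C := by linarith
  have hpow : 0 < (1 + C) ^ ((10 : ℝ) - 3) := Real.rpow_pos_of_pos (by linarith) _
  have key3 : (C + 1) ^ (-(3 : ℝ) / 2) ≤ C / (1 + C) ^ ((10 : ℝ) - 3) := by
    refine le_of_mul_le_mul_left ?_ hApos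
    calc A * (C + 1) ^ (-(3 : ℝ) / 2) ≤ C / (1 + C) ^ ((10 : ℝ) - 3) * A := key'
      _ = A * (C / (1 + C) ^ ((10 : ℝ) - 3)) := by ring
  have h1 : (C + 1) ^ (-(3 : ℝ) / 2) * (1 + C) ^ ((10 : ℝ) - 3) ≤ C := (le_div_iff₀ hpow).mp key3
  have h2 : (C + 1) ^ (-(3 : ℝ) / 2) * (1 + C) ^ ((10 : ℝ) - 3) = (1 + C) ^ ((11 : ℝ) / 2) := by
    rw [add_comm C 1, ← Real.rpow_add (by linarith)]
    norm_num
  rw [h2] at h1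
  have h3 : 1 + C ≤ (1 + C) ^ ((11 : ℝ) / 2) := by
    calc 1 + C = (1 + C) ^ (1 : ℝ) := (Real.rpow_one _).symm
      _ ≤ (1 + C) ^ ((11 : ℝ) / 2) := Real.rpow_le_rpow_of_exponent_le hb (by norm_num)
  linarith

/-- **`Step_70` is false** (the printed range `K > 5` includes `K = 11/2`, where the exponent
`(K−4)/2 = 3/4 ≤ 1` and `∫₀^∞ ds/(1+s)^{3/4} = ∞`). -/
theorem not_Step_70 : ¬ Step_70 := fun h =>
  not_integrableOn_one_add_rpow_of_le (a := ((5.5 : ℝ) - 4) / 2) (by norm_num) (h 5.5 (by norm_num))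

end Summit.NavierStokesRegularity.NavierStokesRegularity.Theorems.Rockwell2025

end
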